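import Literature.NumberTheory.CubicFields.MaximalDiscriminantValuation
import Literature.NumberTheory.CubicFields.ReducibleMaximality
import Literature.NumberTheory.QuadraticFields.LocalFundamental
import HarnessLib

/-!
# BTT §5's sieving sets `Ψ_{p²}`: "nonmaximal at `p` or a triple root `(mod p)`" ⟺ `Disc` not locally fundamental at `p`

Topic `Literature/NumberTheory/CubicFields`, on `DavenportHeilbronnMaximality.MemU` (the
Davenport–Heilbronn set `U_p`, BTT Prop. 2.2), `SingularZeroModP` / `MaximalDiscriminantValuation`
(for `f ∈ U_p` with `p ∣ Disc` a translate has `p ∥ a`, `p ∣ b`; then `p ∤ c ⇒ p² ∤ Disc` at odd `p`,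
`2⁴ ∤ Disc` at `2`) and `QuadraticFields.IsFundAt` (local fundamentality of an integer at `p`).

Bhargava–Taniguchi–Thorne 2023, §5: "we write `Ψ_{p²}` for the characteristic function of … those
`x ∈ V(ℤ/p²ℤ)` that are nonmaximal at `p` or have a triple root `(mod p)`. When `p > 2`, this is
equivalent to requiring that `p² ∣ Disc(x)`." (Davenport–Heilbronn 1971, §§2–3: a form in `U_p` has
`p² ∤ D` unless it is congruent to a constant times the cube of a linear form mod `p`.) This file
PROVES that remark, and its analogue at `p = 2`, so that the set sieved out at `p` in §5 is, for EVERY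
prime `p`, `{x : Disc x not locally fundamental at p}` — the spelling used by the tree's
`FundCubicFieldCountSieve.nonFundCount` (`= N^±(X, Ψ_{q²})` literally):

* `BinaryCubic.HasTripleRootMod p f` — some `GL₂(ℤ)`-translate of `f` is `≡ d·v³ (mod p)`
  (`p ∣ a, b, c`): `f` is a constant times the cube of a linear form mod `p` (for `p ∤ f`);
* `sq_dvd_disc_of_not_memU`, `HasTripleRootMod.sq_dvd_disc` — both conditions force `p² ∣ Disc`;
* **`not_memU_or_hasTripleRootMod_iff_sq_dvd_disc`** (`p` odd): `Ψ_{p²}(f) ⟺ p² ∣ Disc f`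
  (`⟸`: `f ∈ U_p`, `p² ∣ Disc` ⇒ translate with `p ∥ a`, `p ∣ b`, and `p ∣ c` by
  `not_sq_dvd_disc_of_not_dvd_c`, i.e. `≡ d v³`), hence `⟺ ¬ IsFundAt p (Disc f)`;
* **`not_memU_or_hasTripleRootMod_two_iff`** (`p = 2`): `Ψ_4(f) ⟺ Disc f ≡ 0, 4 (mod 16) ⟺
  ¬ IsFundAt 2 (Disc f)` (`⟹`: nonmaximal ⇒ `Disc = 4E`, `E ≡ 0, 1 (4)`; triple root ⇒
  `Disc ≡ 4(a'd)² (16)`; `⟸`: for `f ∈ U_2` without triple root and `2 ∣ Disc`, the translate with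
  `2 ∥ a`, `2 ∣ b` has `c` odd and then `Disc ≡ 8, 12 (mod 16)`, an identity checked by `ring` in the
  four parity classes of `(b/2, d)`);
* `btt_psi_iff_not_isFundAt` — both primes at once: for every prime `p`,
  `(f ∉ U_p ∨ f has a triple root mod p) ⟺ ¬ IsFundAt p (Disc f)`.

## References

* M. Bhargava, T. Taniguchi, F. Thorne, *Improved error estimates for the Davenport–Heilbronn
  theorems*, Math. Ann. 389 (2024) = arXiv:2107.12819, §5 (definition of `Ψ_{p²}` and the remark
  "When p > 2, this is equivalent to requiring that p² ∣ Disc(x)") [BhargavaTaniguchiThorne2023].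
* H. Davenport, H. Heilbronn, *On the density of discriminants of cubic fields. II*, Proc. Roy. Soc.
  London A 322 (1971) 405–420, §§2–3 [DavenportHeilbronn1971].
-/

namespace Literature.NumberTheory.CubicFields

namespace BinaryCubic

open Literature.NumberTheory.QuadraticFields

variable {f : BinaryCubic ℤ} {p : ℕ}

/-! ### Triple roots modulo `p` -/

/-- **`f` has a triple root modulo `p`**: some `GL₂(ℤ)`-translate `g ~ f` has `p ∣ a, b, c`, i.e.
`g ≡ d·v³ (mod p)` — `f` is congruent to a constant times the cube of a linear form modulo `p`
(Davenport–Heilbronn; BTT §5 "have a triple root `(mod p)`"; vacuous-direction note: a multiple of `p`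
also qualifies, harmlessly, as it is nonmaximal anyway). [cite: BhargavaTaniguchiThorne2023, §5 (forms with a triple root mod p)] -/
def HasTripleRootMod (p : ℕ) (f : BinaryCubic ℤ) : Prop :=
  ∃ g : BinaryCubic ℤ, GL2ZEquiv f g ∧ (p : ℤ) ∣ g.a ∧ (p : ℤ) ∣ g.b ∧ (p : ℤ) ∣ g.c

/-- `p ∣ a, b, c` forces `p² ∣ Disc` (every monomial of `Disc` has two factors among `a, b, c`). [folklore] -/
theorem sq_dvd_disc_of_dvd_abc {q : ℤ} {g : BinaryCubic ℤ} (ha : q ∣ g.a) (hb : q ∣ g.b) (hc : q ∣ g.c) :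
    q ^ 2 ∣ g.disc := by
  obtain ⟨a', ha'⟩ := ha
  obtain ⟨b', hb'⟩ := hb
  obtain ⟨c', hc'⟩ := hc
  refine ⟨b' ^ 2 * c' ^ 2 * q ^ 2 - 4 * a' * c' ^ 3 * q ^ 2 - 4 * b' ^ 3 * g.d * q - 27 * a' ^ 2 * g.d ^ 2 +
    18 * a' * b' * c' * g.d * q, ?_⟩
  rw [disc_eq, ha', hb', hc']
  ring

/-- A triple root modulo `p` forces `p² ∣ Disc f`. [folklore] -/
theorem HasTripleRootMod.sq_dvd_disc (h : f.HasTripleRootMod p) : (p : ℤ) ^ 2 ∣ f.disc := by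
  obtain ⟨g, hfg, ha, hb, hc⟩ := h
  rw [← hfg.disc_eq]
  exact sq_dvd_disc_of_dvd_abc ha hb hc

/-- The property is a `GL₂(ℤ)`-invariant. [folklore] -/
theorem HasTripleRootMod.of_gl2zEquiv {g : BinaryCubic ℤ} (h : f.HasTripleRootMod p) (hfg : GL2ZEquiv f g) :
    g.HasTripleRootMod p := by
  obtain ⟨k, hfk, ha, hb, hc⟩ := h
  exact ⟨k, hfg.symm.trans hfk, ha, hb, hc⟩

/-- **Nonmaximal at `p` forces `p² ∣ Disc f`**: a multiple of `p` has `p² ∣ Disc` trivially, and a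
translate with `p² ∣ a`, `p ∣ b` has `Disc = p² E` (`exists_disc_eq_sq_mul`). [folklore] -/
theorem sq_dvd_disc_of_not_memU (h : ¬ f.MemU p) : (p : ℤ) ^ 2 ∣ f.disc := by
  unfold MemU at h
  push Not at h
  by_cases hm : f.IsMultiple p
  · exact sq_dvd_disc_of_dvd_abc hm.1 hm.2.1 hm.2.2.1
  · obtain ⟨g, hfg, hga, hgb⟩ := h hm
    obtain ⟨E, hE, -⟩ := exists_disc_eq_sq_mul hga hgb
    rw [← hfg.disc_eq, hE]
    exact dvd_mul_right _ _

/-! ### Odd `p`: BTT's remark "equivalent to `p² ∣ Disc`" -/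

/-- **For `f ∈ U_p` (`p` odd) with `p² ∣ Disc f`, `f` has a triple root mod `p`** (Davenport–Heilbronn
§§2–3): the translate with `p ∥ a`, `p ∣ b` must have `p ∣ c` (`not_sq_dvd_disc_of_not_dvd_c`).
[cite: DavenportHeilbronn1971, §§2–3 (U_p ⊂ V_p: p² ∤ D unless f ≡ λ ℓ³ mod p)] -/
theorem hasTripleRootMod_of_memU_of_sq_dvd_disc (hp : p.Prime) (hp2 : p ≠ 2) (hU : f.MemU p)
    (h : (p : ℤ) ^ 2 ∣ f.disc) : f.HasTripleRootMod p := by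
  have hD : (p : ℤ) ∣ f.disc := (dvd_pow_self _ two_ne_zero).trans h
  obtain ⟨g, hfg, hga, hgb⟩ := exists_gl2zEquiv_dvd_a_dvd_b hp hU.1 hD
  have hUg : g.MemU p := hU.of_gl2zEquiv hfg
  have hga2 : ¬ (p : ℤ) ^ 2 ∣ g.a := fun h2 => hUg.2 ⟨g, GL2ZEquiv.refl g, h2, hgb⟩
  by_cases hgc : (p : ℤ) ∣ g.c
  · exact ⟨g, hfg, hga, hgb, hgc⟩
  · exact absurd (by rwa [← hfg.disc_eq] at h) (not_sq_dvd_disc_of_not_dvd_c hp hp2 hga hga2 hgb hgc)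

/-- **BTT §5, `p > 2`: "nonmaximal at `p` or a triple root mod `p`" ⟺ `p² ∣ Disc`.**
[cite: BhargavaTaniguchiThorne2023, §5 ("When p > 2, this is equivalent to requiring that p² ∣ Disc(x)")] -/
theorem not_memU_or_hasTripleRootMod_iff_sq_dvd_disc (hp : p.Prime) (hp2 : p ≠ 2) :
    (¬ f.MemU p ∨ f.HasTripleRootMod p) ↔ (p : ℤ) ^ 2 ∣ f.disc := by
  constructor
  · rintro (h | h)
    · exact sq_dvd_disc_of_not_memU h
    · exact h.sq_dvd_disc
  · intro h
    by_cases hU : f.MemU p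
    · exact Or.inr (hasTripleRootMod_of_memU_of_sq_dvd_disc hp hp2 hU h)
    · exact Or.inl hU

/-- Hence, at odd `p`, BTT's sieving condition is "`Disc f` not locally fundamental at `p`". [cite: BhargavaTaniguchiThorne2023, §5 (Ψ_{p²} for p > 2)] -/
theorem not_memU_or_hasTripleRootMod_iff_not_isFundAt (hp : p.Prime) (hp2 : p ≠ 2) :
    (¬ f.MemU p ∨ f.HasTripleRootMod p) ↔ ¬ IsFundAt p f.disc := by
  rw [not_memU_or_hasTripleRootMod_iff_sq_dvd_disc hp hp2, isFundAt_of_ne_two hp2, not_not]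

/-! ### `p = 2`: `Ψ_4(f) ⟺ Disc f ≡ 0, 4 (mod 16)` -/

/-- The case `2 ∥ a`, `2 ∣ b`, `2 ∤ c`: `Disc ≡ 8` or `12 (mod 16)` (an identity `Disc = 16 Q + r` in
each parity class of `(b/2, d)`). [folklore] -/
theorem disc_emod_sixteen_of_two_dvd {g : BinaryCubic ℤ} (ha : (2 : ℤ) ∣ g.a) (ha2 : ¬ (2 : ℤ) ^ 2 ∣ g.a)
    (hb : (2 : ℤ) ∣ g.b) (hc : ¬ (2 : ℤ) ∣ g.c) : g.disc % 16 = 8 ∨ g.disc % 16 = 12 := by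
  obtain ⟨a₁, ha₁⟩ := ha
  have ha₁odd : ¬ (2 : ℤ) ∣ a₁ := fun h => ha2 (by rw [ha₁, pow_two]; exact mul_dvd_mul_left _ h)
  obtain ⟨a₂, ha₂⟩ : ∃ a₂, a₁ = 2 * a₂ + 1 := ⟨a₁ / 2, by omega⟩
  obtain ⟨b₁, hb₁⟩ := hb
  obtain ⟨c₁, hc₁⟩ : ∃ c₁, g.c = 2 * c₁ + 1 := ⟨g.c / 2, by omega⟩
  have hD := disc_eq g
  rcases Int.emod_two_eq_zero_or_one b₁ with hbp | hbp <;> rcases Int.emod_two_eq_zero_or_one g.d with hdp | hdp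
  · obtain ⟨b₂, rfl⟩ : ∃ b₂, b₁ = 2 * b₂ := ⟨b₁ / 2, by omega⟩
    obtain ⟨d₁, hd₁⟩ : ∃ d₁, g.d = 2 * d₁ := ⟨g.d / 2, by omega⟩
    left
    have : g.disc = 16 * (-1 - 27*d₁^2 - 3*c₁ - 6*c₁^2 - 4*c₁^3 + 18*b₂*d₁ + 36*b₂*c₁*d₁ + b₂^2 + 4*b₂^2*c₁
      + 4*b₂^2*c₁^2 - 32*b₂^3*d₁ - a₂ - 108*a₂*d₁^2 - 6*a₂*c₁ - 12*a₂*c₁^2 - 8*a₂*c₁^3 + 36*a₂*b₂*d₁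
      + 72*a₂*b₂*c₁*d₁ - 108*a₂^2*d₁^2) + 8 := by
      rw [hD, ha₁, ha₂, hb₁, hc₁, hd₁]; ring
    omega
  · obtain ⟨b₂, rfl⟩ : ∃ b₂, b₁ = 2 * b₂ := ⟨b₁ / 2, by omega⟩
    obtain ⟨d₁, hd₁⟩ : ∃ d₁, g.d = 2 * d₁ + 1 := ⟨g.d / 2, by omega⟩
    right
    have : g.disc = 16 * (-8 - 27*d₁ - 27*d₁^2 - 3*c₁ - 6*c₁^2 - 4*c₁^3 + 9*b₂ + 18*b₂*d₁ + 18*b₂*c₁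
      + 36*b₂*c₁*d₁ + b₂^2 + 4*b₂^2*c₁ + 4*b₂^2*c₁^2 - 16*b₂^3 - 32*b₂^3*d₁ - 28*a₂ - 108*a₂*d₁ - 108*a₂*d₁^2
      - 6*a₂*c₁ - 12*a₂*c₁^2 - 8*a₂*c₁^3 + 18*a₂*b₂ + 36*a₂*b₂*d₁ + 36*a₂*b₂*c₁ + 72*a₂*b₂*c₁*d₁ - 27*a₂^2
      - 108*a₂^2*d₁ - 108*a₂^2*d₁^2) + 12 := by
      rw [hD, ha₁, ha₂, hb₁, hc₁, hd₁]; ring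
    omega
  · obtain ⟨b₂, rfl⟩ : ∃ b₂, b₁ = 2 * b₂ + 1 := ⟨b₁ / 2, by omega⟩
    obtain ⟨d₁, hd₁⟩ : ∃ d₁, g.d = 2 * d₁ := ⟨g.d / 2, by omega⟩
    right
    have : g.disc = 16 * (-1 + 5*d₁ - 27*d₁^2 - 2*c₁ + 18*c₁*d₁ - 5*c₁^2 - 4*c₁^3 + b₂ - 6*b₂*d₁ + 4*b₂*c₁
      + 36*b₂*c₁*d₁ + 4*b₂*c₁^2 + b₂^2 - 48*b₂^2*d₁ + 4*b₂^2*c₁ + 4*b₂^2*c₁^2 - 32*b₂^3*d₁ - a₂ + 18*a₂*d₁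
      - 108*a₂*d₁^2 - 6*a₂*c₁ + 36*a₂*c₁*d₁ - 12*a₂*c₁^2 - 8*a₂*c₁^3 + 36*a₂*b₂*d₁ + 72*a₂*b₂*c₁*d₁
      - 108*a₂^2*d₁^2) + 12 := by
      rw [hD, ha₁, ha₂, hb₁, hc₁, hd₁]; ring
    omega
  · obtain ⟨b₂, rfl⟩ : ∃ b₂, b₁ = 2 * b₂ + 1 := ⟨b₁ / 2, by omega⟩
    obtain ⟨d₁, hd₁⟩ : ∃ d₁, g.d = 2 * d₁ + 1 := ⟨g.d / 2, by omega⟩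
    left
    have : g.disc = 16 * (-5 - 22*d₁ - 27*d₁^2 + 7*c₁ + 18*c₁*d₁ - 5*c₁^2 - 4*c₁^3 - 2*b₂ - 6*b₂*d₁ + 22*b₂*c₁
      + 36*b₂*c₁*d₁ + 4*b₂*c₁^2 - 23*b₂^2 - 48*b₂^2*d₁ + 4*b₂^2*c₁ + 4*b₂^2*c₁^2 - 16*b₂^3 - 32*b₂^3*d₁ - 19*a₂
      - 90*a₂*d₁ - 108*a₂*d₁^2 + 12*a₂*c₁ + 36*a₂*c₁*d₁ - 12*a₂*c₁^2 - 8*a₂*c₁^3 + 18*a₂*b₂ + 36*a₂*b₂*d₁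
      + 36*a₂*b₂*c₁ + 72*a₂*b₂*c₁*d₁ - 27*a₂^2 - 108*a₂^2*d₁ - 108*a₂^2*d₁^2) + 8 := by
      rw [hD, ha₁, ha₂, hb₁, hc₁, hd₁]; ring
    omega

/-- A triple root modulo `2` forces `Disc ≡ 0, 4 (mod 16)` (`Disc(2a', 2b', 2c', d) ≡ 4(a'd)² (16)`). [folklore] -/
theorem disc_emod_sixteen_of_hasTripleRootMod_two (h : f.HasTripleRootMod 2) : f.disc % 16 = 0 ∨ f.disc % 16 = 4 := by
  obtain ⟨g, hfg, ⟨a', ha'⟩, ⟨b', hb'⟩, ⟨c', hc'⟩⟩ := h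
  rw [← hfg.disc_eq]
  have hD : g.disc = 16 * (b' ^ 2 * c' ^ 2 - 4 * a' * c' ^ 3 - 2 * b' ^ 3 * g.d - 7 * a' ^ 2 * g.d ^ 2 + 9 * a' * b' * c' * g.d)
      + 4 * (a' * g.d) ^ 2 := by
    rw [disc_eq, ha', hb', hc']; push_cast; ring
  rcases Int.emod_two_eq_zero_or_one (a' * g.d) with h0 | h1
  · obtain ⟨k, hk⟩ : ∃ k, a' * g.d = 2 * k := ⟨a' * g.d / 2, by omega⟩
    left; rw [hD, hk]; ring_nf; omega
  · obtain ⟨k, hk⟩ : ∃ k, a' * g.d = 2 * k + 1 := ⟨a' * g.d / 2, by omega⟩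
    right; rw [hD, hk]; ring_nf; omega

/-- Nonmaximal at `2` forces `Disc ≡ 0, 4 (mod 16)` (`Disc = 4E` with `E ≡ 0, 1 (mod 4)`, or `2 ∣ f`). [folklore] -/
theorem disc_emod_sixteen_of_not_memU_two (h : ¬ f.MemU 2) : f.disc % 16 = 0 ∨ f.disc % 16 = 4 := by
  unfold MemU at h
  push Not at h
  by_cases hm : f.IsMultiple 2
  · exact disc_emod_sixteen_of_hasTripleRootMod_two ⟨f, GL2ZEquiv.refl f, hm.1, hm.2.1, hm.2.2.1⟩
  · obtain ⟨g, hfg, hga, hgb⟩ := h hm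
    obtain ⟨E, hE, hE4⟩ := exists_disc_eq_sq_mul hga hgb
    rw [← hfg.disc_eq, hE]
    push_cast
    omega

/-- **BTT §5 at `p = 2`: "nonmaximal at `2` or a triple root mod `2`" ⟺ `Disc ≡ 0, 4 (mod 16)` ⟺
`Disc` not locally fundamental at `2`** (the `p = 2` analogue of "equivalent to `p² ∣ Disc`"; note
`4 ∣ Disc` alone is weaker). [cite: BhargavaTaniguchiThorne2023, §5 (Ψ_{p²} at p = 2: nonmaximal at 2 or a triple root mod 2)] -/
theorem not_memU_or_hasTripleRootMod_two_iff : (¬ f.MemU 2 ∨ f.HasTripleRootMod 2) ↔ ¬ IsFundAt 2 f.disc := by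
  rw [isFundAt_two]
  constructor
  · rintro (h | h)
    · rcases disc_emod_sixteen_of_not_memU_two h with h16 | h16 <;> omega
    · rcases disc_emod_sixteen_of_hasTripleRootMod_two h with h16 | h16 <;> omega
  · intro hnf
    by_contra hno
    push Not at hno
    obtain ⟨hU, hnt⟩ := hno
    apply hnf
    rcases disc_emod_four f with h4 | h4
    · -- `2 ∣ Disc`: move the multiple root to `(1:0)`
      have hD : ((2 : ℕ) : ℤ) ∣ f.disc := by omega
      obtain ⟨g, hfg, hga, hgb⟩ := exists_gl2zEquiv_dvd_a_dvd_b Nat.prime_two hU.1 hD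
      have hUg : g.MemU 2 := hU.of_gl2zEquiv hfg
      have hga2 : ¬ ((2 : ℕ) : ℤ) ^ 2 ∣ g.a := fun h2 => hUg.2 ⟨g, GL2ZEquiv.refl g, h2, hgb⟩
      by_cases hgc : ((2 : ℕ) : ℤ) ∣ g.c
      · exact absurd ⟨g, hfg, hga, hgb, hgc⟩ hnt
      · rw [← hfg.disc_eq]
        rcases disc_emod_sixteen_of_two_dvd (by exact_mod_cast hga) (by exact_mod_cast hga2) (by exact_mod_cast hgb)
          (by exact_mod_cast hgc) with h16 | h16 <;> omega
    · exact Or.inl h4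

/-! ### Every prime at once -/

/-- **BTT's sieving set at `p`, for every prime `p`, is `{f : Disc f not locally fundamental at p}`.**
[cite: BhargavaTaniguchiThorne2023, §5 (the two bullets defining Ψ_{p²}, second bullet)] -/
theorem btt_psi_iff_not_isFundAt (hp : p.Prime) : (¬ f.MemU p ∨ f.HasTripleRootMod p) ↔ ¬ IsFundAt p f.disc := by
  by_cases hp2 : p = 2
  · subst hp2; exact not_memU_or_hasTripleRootMod_two_iff
  · exact not_memU_or_hasTripleRootMod_iff_not_isFundAt hp hp2

/-- For squarefree `q`: `Ψ_{q²}(f) = ⊗_{p ∣ q} Ψ_{p²}(f)` holds iff `Disc f` is not locally fundamental at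
any `p ∣ q` — the condition defining `FundCubicFieldCountSieve.nonFundCount`. [cite: BhargavaTaniguchiThorne2023, §5 (Ψ_{q²} := ⊗_{p∣q} Ψ_{p²})] -/
theorem forall_btt_psi_iff_forall_not_isFundAt (q : ℕ) :
    (∀ p ∈ q.primeFactors, ¬ f.MemU p ∨ f.HasTripleRootMod p) ↔ ∀ p ∈ q.primeFactors, ¬ IsFundAt p f.disc :=
  forall₂_congr fun _ hp => btt_psi_iff_not_isFundAt (Nat.prime_of_mem_primeFactors hp)

end BinaryCubic

end Literature.NumberTheory.CubicFields
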